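import Mathlib
import HarnessLib

/-!
# Spacing sums for the weighted Hilbert inequality, I: packing and one-pole sums

Toolkit for the proof of the Montgomery–Vaughan generalised Hilbert inequality
(`Literature.NumberTheory.LFunctions.montgomeryVaughan_hilbertInequality`, Ivić (5.34)), following
the elementary route of Pan Chengdong–Pan Chengbiao, *Foundations of analytic number theory*, Ch. 28
§4 (Shan's method): every spacing sum `∑_r δ_r f(x_r)` over a `δ`-separated configuration
(`0 < δ_r ≤ |x_r - x_s|` for `r ≠ s`) is bounded by `∫ f` over the complement of the excluded
half-neighbourhoods, because `f` is convex on each packing interval `[x_r - δ_r/2, x_r + δ_r/2]`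
(midpoint Hermite–Hadamard) and these intervals are pairwise disjoint.

## Content (all PROVED)

* `two_mul_mul_le_integral_of_convexOn` — midpoint Hermite–Hadamard: `2h f(c) ≤ ∫_{c-h}^{c+h} f`.
* `sum_le_integral_of_disjoint` — the packing principle.
* `sum_erase_mul_le_integral` — packing around one pole `x_s`.
* `sum_weight_div_sq_le`, `sum_weight_div_pow_four_le` — the crude one-pole bounds
  `∑_{r≠s} δ_r (x_r-x_s)^{-2} ≤ 4 δ_s^{-1}` and `∑_{r≠s} δ_r (x_r-x_s)^{-4} ≤ (16/3) δ_s^{-3}`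
  (Pan–Pan, Ch. 28 §4, the rôle of (27)–(30), proved with the integral comparison (5) of loc. cit.
  in place of Shan's sharp constants `ζ(2)`, `ζ(4)`).

## Not here

The sharp constants `π²/6`, `π⁴/90` per side (Preissmann / Shan) are not needed for the constant
`3π/2` and are not proved.  The two-pole sum (Pan–Pan, Ch. 28 §4, Lemma 3) is in
`HilbertInequalityTwoPole.lean`.

## Sources

* Pan Chengdong, Pan Chengbiao, *解析数论基础 (Foundations of analytic number theory)*, Science
  Press, Beijing 1991, Ch. 28 §4.
* H. L. Montgomery, R. C. Vaughan, *Hilbert's inequality*, J. London Math. Soc. (2) 8 (1974) 73–82.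
-/

open Real MeasureTheory Set

namespace Literature.NumberTheory.LFunctions.MontgomeryVaughan

/-! ### Hermite–Hadamard and the packing principle -/

/-- **Midpoint Hermite–Hadamard inequality**: if `f` is convex and continuous on `[c-h, c+h]`
(`h ≥ 0`) then `2h·f(c) ≤ ∫_{c-h}^{c+h} f`.  Proof: `2f(c) ≤ f(c-y) + f(c+y)` for `0 ≤ y ≤ h`,
integrate in `y`. [folklore] -/
theorem two_mul_mul_le_integral_of_convexOn {f : ℝ → ℝ} {c h : ℝ} (hh : 0 ≤ h)
    (hconv : ConvexOn ℝ (Icc (c - h) (c + h)) f)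
    (hcont : ContinuousOn f (Icc (c - h) (c + h))) :
    2 * h * f c ≤ ∫ y in (c - h)..(c + h), f y := by
  have hpt : ∀ y ∈ Icc 0 h, 2 * f c ≤ f (c - y) + f (c + y) := by
    intro y hy
    have hx1 : c - y ∈ Icc (c - h) (c + h) := ⟨by linarith [hy.2], by linarith [hy.1]⟩
    have hx2 : c + y ∈ Icc (c - h) (c + h) := ⟨by linarith [hy.1], by linarith [hy.2]⟩
    have key := hconv.2 hx1 hx2 (show (0:ℝ) ≤ 1 / 2 by norm_num) (show (0:ℝ) ≤ 1 / 2 by norm_num)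
      (by norm_num)
    have hmid : (1 / 2 : ℝ) • (c - y) + (1 / 2 : ℝ) • (c + y) = c := by
      simp only [smul_eq_mul]; ring
    rw [hmid] at key
    simp only [smul_eq_mul] at key
    linarith
  have hc1 : ContinuousOn (fun y => f (c - y)) (uIcc 0 h) := by
    rw [Set.uIcc_of_le hh]
    refine hcont.comp (by fun_prop) fun y hy => ?_
    exact ⟨by linarith [hy.2], by linarith [hy.1]⟩
  have hc2 : ContinuousOn (fun y => f (c + y)) (uIcc 0 h) := by
    rw [Set.uIcc_of_le hh]
    refine hcont.comp (by fun_prop) fun y hy => ?_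
    exact ⟨by linarith [hy.1], by linarith [hy.2]⟩
  have hi1 : IntervalIntegrable (fun y => f (c - y)) volume 0 h := hc1.intervalIntegrable
  have hi2 : IntervalIntegrable (fun y => f (c + y)) volume 0 h := hc2.intervalIntegrable
  have hmono : ∫ _ in (0:ℝ)..h, 2 * f c ≤ ∫ y in (0:ℝ)..h, (f (c - y) + f (c + y)) :=
    intervalIntegral.integral_mono_on hh intervalIntegrable_const (hi1.add hi2)
      (fun y hy => hpt y hy)
  rw [intervalIntegral.integral_const, intervalIntegral.integral_add hi1 hi2,
    intervalIntegral.integral_comp_sub_left (fun y => f y) c,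
    intervalIntegral.integral_comp_add_left (fun y => f y) c] at hmono
  simp only [sub_zero, add_zero, smul_eq_mul] at hmono
  have hf1 : IntervalIntegrable f volume (c - h) c := by
    refine (hcont.mono ?_).intervalIntegrable
    rw [Set.uIcc_of_le (by linarith)]
    exact Icc_subset_Icc le_rfl (by linarith)
  have hf2 : IntervalIntegrable f volume c (c + h) := by
    refine (hcont.mono ?_).intervalIntegrable
    rw [Set.uIcc_of_le (by linarith)]
    exact Icc_subset_Icc (by linarith) le_rfl
  rw [← intervalIntegral.integral_add_adjacent_intervals hf1 hf2]
  linarith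

/-- Two symmetric intervals whose radii add up to at most the distance of their centres are
disjoint (half-open version). [folklore] -/
theorem Ioc_disjoint_Ioc_of_add_le_abs {p q ρ σ : ℝ} (h : ρ + σ ≤ |p - q|) :
    Disjoint (Ioc (p - ρ) (p + ρ)) (Ioc (q - σ) (q + σ)) := by
  rw [Set.Ioc_disjoint_Ioc]
  rcases le_or_gt p q with hpq | hpq
  · rw [abs_of_nonpos (by linarith)] at h
    calc min (p + ρ) (q + σ) ≤ p + ρ := min_le_left _ _
      _ ≤ q - σ := by linarith
      _ ≤ max (p - ρ) (q - σ) := le_max_right _ _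
  · rw [abs_of_pos (by linarith)] at h
    calc min (p + ρ) (q + σ) ≤ q + σ := min_le_right _ _
      _ ≤ p - ρ := by linarith
      _ ≤ max (p - ρ) (q - σ) := le_max_left _ _

/-- **Packing principle**: if the half-open intervals `(p_r - ρ_r, p_r + ρ_r]` (`r ∈ S`) are pairwise
disjoint and contained in a measurable set `D`, and `f ≥ 0` is integrable on `D` and convex and
continuous on each `[p_r - ρ_r, p_r + ρ_r]`, then `∑_{r∈S} 2ρ_r f(p_r) ≤ ∫_D f`. [folklore] -/
theorem sum_le_integral_of_disjoint {ι : Type*} (S : Finset ι) (p ρ : ι → ℝ) (f : ℝ → ℝ)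
    (D : Set ℝ) (hD : MeasurableSet D) (hρ : ∀ r ∈ S, 0 ≤ ρ r)
    (hconv : ∀ r ∈ S, ConvexOn ℝ (Icc (p r - ρ r) (p r + ρ r)) f)
    (hcont : ∀ r ∈ S, ContinuousOn f (Icc (p r - ρ r) (p r + ρ r)))
    (hsub : ∀ r ∈ S, Ioc (p r - ρ r) (p r + ρ r) ⊆ D)
    (hdisj : (S : Set ι).Pairwise (Function.onFun Disjoint fun r => Ioc (p r - ρ r) (p r + ρ r)))
    (hf0 : ∀ y ∈ D, 0 ≤ f y) (hfint : IntegrableOn f D) :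
    ∑ r ∈ S, 2 * ρ r * f (p r) ≤ ∫ y in D, f y := by
  calc ∑ r ∈ S, 2 * ρ r * f (p r) ≤ ∑ r ∈ S, ∫ y in (p r - ρ r)..(p r + ρ r), f y :=
        Finset.sum_le_sum fun r hr =>
          two_mul_mul_le_integral_of_convexOn (hρ r hr) (hconv r hr) (hcont r hr)
    _ = ∑ r ∈ S, ∫ y in Ioc (p r - ρ r) (p r + ρ r), f y := by
        refine Finset.sum_congr rfl fun r hr => ?_
        exact intervalIntegral.integral_of_le (by linarith [hρ r hr])
    _ = ∫ y in ⋃ r ∈ S, Ioc (p r - ρ r) (p r + ρ r), f y := by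
        rw [integral_biUnion_finset S (fun r _ => measurableSet_Ioc) hdisj
          (fun r hr => hfint.mono_set (hsub r hr))]
    _ ≤ ∫ y in D, f y := by
        refine setIntegral_mono_set hfint ?_ ?_
        · exact (ae_restrict_iff' hD).mpr (Filter.Eventually.of_forall hf0)
        · exact (Set.iUnion₂_subset fun r hr => hsub r hr).eventuallyLE

/-! ### Convexity of inverse powers -/

/-- `y ↦ (y - a)^{-n}` is convex on `(a, ∞)`. [folklore] -/
theorem convexOn_inv_pow_sub_Ioi (a : ℝ) (n : ℕ) :
    ConvexOn ℝ (Ioi a) (fun y => ((y - a) ^ n)⁻¹) := by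
  have h := (convexOn_zpow (𝕜 := ℝ) (-(n : ℤ))).translate_right (-a)
  have hs : (fun z : ℝ => -a + z) ⁻¹' Ioi 0 = Ioi a := by
    ext z
    simp only [Set.mem_preimage, Set.mem_Ioi]
    constructor <;> intro hz <;> linarith
  rw [hs] at h
  refine h.congr fun z _ => ?_
  simp only [Function.comp_apply, zpow_neg, zpow_natCast, neg_add_eq_sub]

/-- `y ↦ (a - y)^{-n}` is convex on `(-∞, a)`. [folklore] -/
theorem convexOn_inv_pow_sub_Iio (a : ℝ) (n : ℕ) :
    ConvexOn ℝ (Iio a) (fun y => ((a - y) ^ n)⁻¹) := by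
  have h := (convexOn_inv_pow_sub_Ioi (-a) n).comp_linearMap (-LinearMap.id)
  have hs : ((-LinearMap.id : ℝ →ₗ[ℝ] ℝ)) ⁻¹' Ioi (-a) = Iio a := by
    ext z
    simp only [Set.mem_preimage, LinearMap.neg_apply, LinearMap.id_coe, id_eq, Set.mem_Ioi,
      Set.mem_Iio]
    constructor <;> intro hz <;> linarith
  rw [hs] at h
  refine h.congr fun z _ => ?_
  simp only [Function.comp_apply, LinearMap.neg_apply, LinearMap.id_coe, id_eq]
  congr 1
  ring

/-- Even inverse powers `((y - a)^{2k})⁻¹` are convex on `(-∞, a)` as well (as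
`(y - a)^{2k} = (a - y)^{2k}`); used with `k = 1, 2`. [folklore] -/
theorem convexOn_inv_even_pow_sub_Iio (a : ℝ) (k : ℕ) :
    ConvexOn ℝ (Iio a) (fun y => ((y - a) ^ (2 * k))⁻¹) := by
  refine (convexOn_inv_pow_sub_Iio a (2 * k)).congr fun z _ => ?_
  simp only [pow_mul]
  congr 2
  ring

/-! ### An elementary logarithmic inequality -/

/-- `log t ≤ (t - 1/t)/2` for `t ≥ 1` (i.e. `u ≤ sinh u` for `u = log t ≥ 0`). [folklore] -/
theorem log_le_sub_inv_div_two {t : ℝ} (ht : 1 ≤ t) : Real.log t ≤ (t - t⁻¹) / 2 := by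
  have ht0 : 0 < t := by linarith
  have h1 : 0 ≤ Real.log t := Real.log_nonneg ht
  have h2 := Real.self_le_sinh_iff.mpr h1
  rwa [Real.sinh_eq, Real.exp_neg, Real.exp_log ht0] at h2

/-! ### One-pole spacing sums -/

section OnePole

variable {ι : Type*} [Fintype ι] [DecidableEq ι] {x δ : ι → ℝ}

/-- Packing around one pole: for a `δ`-separated configuration and `f ≥ 0` convex on both sides of
`x_s` and continuous off `x_s`,
`∑_{r ≠ s} δ_r f(x_r) ≤ ∫_{[x_s - T, x_s - δ_s/2]} f + ∫_{[x_s + δ_s/2, x_s + T]} f` with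
`T = ∑_r (|x_r - x_s| + δ_r)`. [folklore] -/
theorem sum_erase_mul_le_integral (hδ : ∀ r, 0 < δ r)
    (hsep : ∀ r s, r ≠ s → δ r ≤ |x r - x s|) (s : ι) (f : ℝ → ℝ)
    (hconvL : ConvexOn ℝ (Iio (x s)) f) (hconvR : ConvexOn ℝ (Ioi (x s)) f)
    (hcont : ContinuousOn f {y | y ≠ x s}) (hf0 : ∀ y, 0 ≤ f y) :
    ∑ r ∈ Finset.univ.erase s, δ r * f (x r) ≤
      (∫ y in Icc (x s - ∑ r, (|x r - x s| + δ r)) (x s - δ s / 2), f y) +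
        ∫ y in Icc (x s + δ s / 2) (x s + ∑ r, (|x r - x s| + δ r)), f y := by
  set T : ℝ := ∑ r, (|x r - x s| + δ r) with hT
  have hTr : ∀ r, |x r - x s| + δ r ≤ T := fun r =>
    Finset.single_le_sum (f := fun r => |x r - x s| + δ r)
      (fun i _ => by have := hδ i; positivity) (Finset.mem_univ r)
  have hTs : δ s ≤ T := by
    have := hTr s
    rwa [sub_self, abs_zero, zero_add] at this
  have hδs := hδ s
  set D : Set ℝ := Icc (x s - T) (x s - δ s / 2) ∪ Icc (x s + δ s / 2) (x s + T) with hD_def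
  have hDm : MeasurableSet D := measurableSet_Icc.union measurableSet_Icc
  -- where the packing intervals live
  have hleft : ∀ r, r ≠ s → x r < x s →
      x r + δ r / 2 ≤ x s - δ s / 2 ∧ x s - T ≤ x r - δ r / 2 := by
    intro r hr hlt
    have h1 := hsep r s hr
    have h2 := hsep s r (Ne.symm hr)
    rw [abs_of_neg (by linarith)] at h1
    rw [abs_of_pos (by linarith)] at h2
    have h3 := hTr r
    rw [abs_of_neg (by linarith)] at h3
    have h4 := hδ r
    constructor <;> linarith
  have hright : ∀ r, r ≠ s → x s < x r →
      x s + δ s / 2 ≤ x r - δ r / 2 ∧ x r + δ r / 2 ≤ x s + T := by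
    intro r hr hlt
    have h1 := hsep r s hr
    have h2 := hsep s r (Ne.symm hr)
    rw [abs_of_pos (by linarith)] at h1
    rw [abs_of_neg (by linarith)] at h2
    have h3 := hTr r
    rw [abs_of_pos (by linarith)] at h3
    have h4 := hδ r
    constructor <;> linarith
  have hne : ∀ r, r ≠ s → x r ≠ x s := by
    intro r hr h
    have := hsep r s hr
    rw [h, sub_self, abs_zero] at this
    linarith [hδ r]
  have hintL : IntegrableOn f (Icc (x s - T) (x s - δ s / 2)) := by
    refine (hcont.mono ?_).integrableOn_Icc
    intro y hy; simp only [Set.mem_setOf_eq]; intro h; rw [h] at hy; linarith [hy.2]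
  have hintR : IntegrableOn f (Icc (x s + δ s / 2) (x s + T)) := by
    refine (hcont.mono ?_).integrableOn_Icc
    intro y hy; simp only [Set.mem_setOf_eq]; intro h; rw [h] at hy; linarith [hy.1]
  have key := sum_le_integral_of_disjoint (Finset.univ.erase s) x (fun r => δ r / 2) f D hDm
    (fun r _ => by linarith [hδ r]) ?_ ?_ ?_ ?_ (fun y _ => hf0 y) (hintL.union hintR)
  · calc ∑ r ∈ Finset.univ.erase s, δ r * f (x r)
          = ∑ r ∈ Finset.univ.erase s, 2 * (δ r / 2) * f (x r) :=
            Finset.sum_congr rfl fun r _ => by ring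
      _ ≤ ∫ y in D, f y := key
      _ = _ := by
        rw [hD_def, setIntegral_union ?_ measurableSet_Icc hintL hintR]
        exact Set.disjoint_left.mpr fun y hy hy' => by linarith [hy.2, hy'.1]
  · -- convexity on each packing interval
    intro r hr
    have hr' := (Finset.mem_erase.mp hr).1
    rcases lt_or_gt_of_ne (hne r hr') with hlt | hgt
    · refine hconvL.subset (fun y hy => ?_) (convex_Icc _ _)
      simp only [Set.mem_Iio]; linarith [hy.2, (hleft r hr' hlt).1]
    · refine hconvR.subset (fun y hy => ?_) (convex_Icc _ _)
      simp only [Set.mem_Ioi]; linarith [hy.1, (hright r hr' hgt).1]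
  · -- continuity on each packing interval
    intro r hr
    have hr' := (Finset.mem_erase.mp hr).1
    refine hcont.mono fun y hy => ?_
    simp only [Set.mem_setOf_eq]
    rcases lt_or_gt_of_ne (hne r hr') with hlt | hgt
    · intro h; rw [h] at hy; linarith [hy.2, (hleft r hr' hlt).1]
    · intro h; rw [h] at hy; linarith [hy.1, (hright r hr' hgt).1]
  · -- packing intervals lie in `D`
    intro r hr
    have hr' := (Finset.mem_erase.mp hr).1
    rcases lt_or_gt_of_ne (hne r hr') with hlt | hgt
    · intro y hy
      left
      exact ⟨by linarith [hy.1, (hleft r hr' hlt).2], by linarith [hy.2, (hleft r hr' hlt).1]⟩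
    · intro y hy
      right
      exact ⟨by linarith [hy.1, (hright r hr' hgt).1], by linarith [hy.2, (hright r hr' hgt).2]⟩
  · -- pairwise disjoint
    intro r _ r' _ hrr'
    have h1 := hsep r r' hrr'
    have h2 := hsep r' r (Ne.symm hrr')
    rw [abs_sub_comm] at h2
    exact Ioc_disjoint_Ioc_of_add_le_abs (by linarith)

/-- **Crude one-pole spacing bound, exponent 2** (the rôle of Pan–Pan Ch. 28 §4 (27)–(28), via the
integral comparison (5) of loc. cit.): for a `δ`-separated configuration,
`∑_{r ≠ s} δ_r (x_r - x_s)^{-2} ≤ 4/δ_s`. [cite: PanPan1991, Ch. 28 §4 Lemma 2] -/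
theorem sum_weight_div_sq_le (hδ : ∀ r, 0 < δ r) (hsep : ∀ r s, r ≠ s → δ r ≤ |x r - x s|)
    (s : ι) : ∑ r ∈ Finset.univ.erase s, δ r / (x r - x s) ^ 2 ≤ 4 / δ s := by
  set T : ℝ := ∑ r, (|x r - x s| + δ r) with hT
  have hTs : δ s ≤ T := by
    have := Finset.single_le_sum (f := fun r => |x r - x s| + δ r)
      (fun i _ => by have := hδ i; positivity) (Finset.mem_univ s)
    simp only [sub_self, abs_zero, zero_add] at this
    exact this
  have hδs := hδ s
  have hT0 : 0 < T := lt_of_lt_of_le hδs hTs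
  set f : ℝ → ℝ := fun y => ((y - x s) ^ 2)⁻¹ with hf
  have hcont : ContinuousOn f {y | y ≠ x s} := by
    refine ContinuousOn.inv₀ (by fun_prop) fun y hy => ?_
    exact pow_ne_zero 2 (sub_ne_zero.mpr hy)
  have key := sum_erase_mul_le_integral hδ hsep s f
    ((convexOn_inv_even_pow_sub_Iio (x s) 1).congr fun y _ => by simp [hf])
    (convexOn_inv_pow_sub_Ioi (x s) 2) hcont (fun y => by positivity)
  have havoid : ∀ p q : ℝ, p ≤ q → (q < x s ∨ x s < p) → ∀ y ∈ uIcc p q, y ≠ x s := by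
    intro p q hpq hside y hy
    rw [Set.uIcc_of_le hpq] at hy
    rcases hside with h | h
    · exact ne_of_lt (lt_of_le_of_lt hy.2 h)
    · exact ne_of_gt (lt_of_lt_of_le h hy.1)
  -- left piece, antiderivative `(x_s - y)⁻¹`
  have h1 : ∫ y in Icc (x s - T) (x s - δ s / 2), f y ≤ 2 / δ s := by
    have hpq : x s - T ≤ x s - δ s / 2 := by linarith
    rw [integral_Icc_eq_integral_Ioc, ← intervalIntegral.integral_of_le hpq,
      intervalIntegral.integral_eq_sub_of_hasDerivAt (f := fun y => (x s - y)⁻¹)]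
    · have e1 : x s - (x s - δ s / 2) = δ s / 2 := by ring
      have e2 : x s - (x s - T) = T := by ring
      rw [e1, e2]
      have : (δ s / 2)⁻¹ - T⁻¹ = 2 / δ s - 1 / T := by field_simp
      rw [this]
      have : 0 < 1 / T := by positivity
      linarith
    · intro y hy
      have hy' := havoid _ _ hpq (Or.inl (by linarith)) y hy
      have hne : x s - y ≠ 0 := sub_ne_zero.mpr (Ne.symm hy')
      refine (((hasDerivAt_id y).const_sub (x s)).fun_inv hne).congr_deriv ?_
      simp only [hf, id_eq]
      field_simp
      ring
    · exact (hcont.mono fun y hy => havoid _ _ hpq (Or.inl (by linarith)) y hy).intervalIntegrable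
  -- right piece, antiderivative `-(y - x_s)⁻¹`
  have h2 : ∫ y in Icc (x s + δ s / 2) (x s + T), f y ≤ 2 / δ s := by
    have hpq : x s + δ s / 2 ≤ x s + T := by linarith
    rw [integral_Icc_eq_integral_Ioc, ← intervalIntegral.integral_of_le hpq,
      intervalIntegral.integral_eq_sub_of_hasDerivAt (f := fun y => -(y - x s)⁻¹)]
    · have e1 : x s + T - x s = T := by ring
      have e2 : x s + δ s / 2 - x s = δ s / 2 := by ring
      rw [e1, e2]
      have : -T⁻¹ - -(δ s / 2)⁻¹ = 2 / δ s - 1 / T := by field_simp; ring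
      rw [this]
      have : 0 < 1 / T := by positivity
      linarith
    · intro y hy
      have hy' := havoid _ _ hpq (Or.inr (by linarith)) y hy
      have hne : y - x s ≠ 0 := sub_ne_zero.mpr hy'
      refine (((hasDerivAt_id y).sub_const (x s)).fun_inv hne).fun_neg.congr_deriv ?_
      simp only [hf, id_eq]
      field_simp
    · exact (hcont.mono fun y hy => havoid _ _ hpq (Or.inr (by linarith)) y hy).intervalIntegrable
  calc ∑ r ∈ Finset.univ.erase s, δ r / (x r - x s) ^ 2
        = ∑ r ∈ Finset.univ.erase s, δ r * f (x r) := by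
          refine Finset.sum_congr rfl fun r _ => ?_
          simp only [hf, div_eq_mul_inv]
    _ ≤ _ := key
    _ ≤ 2 / δ s + 2 / δ s := add_le_add h1 h2
    _ = 4 / δ s := by ring

/-- **Crude one-pole spacing bound, exponent 4** (the rôle of Pan–Pan Ch. 28 §4 (29)–(30), via the
integral comparison (5) of loc. cit.): for a `δ`-separated configuration,
`∑_{r ≠ s} δ_r (x_r - x_s)^{-4} ≤ 16/(3 δ_s³)`. [cite: PanPan1991, Ch. 28 §4 Lemma 2] -/
theorem sum_weight_div_pow_four_le (hδ : ∀ r, 0 < δ r)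
    (hsep : ∀ r s, r ≠ s → δ r ≤ |x r - x s|) (s : ι) :
    ∑ r ∈ Finset.univ.erase s, δ r / (x r - x s) ^ 4 ≤ 16 / (3 * δ s ^ 3) := by
  set T : ℝ := ∑ r, (|x r - x s| + δ r) with hT
  have hTs : δ s ≤ T := by
    have := Finset.single_le_sum (f := fun r => |x r - x s| + δ r)
      (fun i _ => by have := hδ i; positivity) (Finset.mem_univ s)
    simp only [sub_self, abs_zero, zero_add] at this
    exact this
  have hδs := hδ s
  have hT0 : 0 < T := lt_of_lt_of_le hδs hTs
  set f : ℝ → ℝ := fun y => ((y - x s) ^ 4)⁻¹ with hf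
  have hcont : ContinuousOn f {y | y ≠ x s} := by
    refine ContinuousOn.inv₀ (by fun_prop) fun y hy => ?_
    exact pow_ne_zero 4 (sub_ne_zero.mpr hy)
  have key := sum_erase_mul_le_integral hδ hsep s f
    ((convexOn_inv_even_pow_sub_Iio (x s) 2).congr fun y _ => by simp [hf])
    (convexOn_inv_pow_sub_Ioi (x s) 4) hcont (fun y => by positivity)
  have havoid : ∀ p q : ℝ, p ≤ q → (q < x s ∨ x s < p) → ∀ y ∈ uIcc p q, y ≠ x s := by
    intro p q hpq hside y hy
    rw [Set.uIcc_of_le hpq] at hy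
    rcases hside with h | h
    · exact ne_of_lt (lt_of_le_of_lt hy.2 h)
    · exact ne_of_gt (lt_of_lt_of_le h hy.1)
  -- left piece, antiderivative `((x_s - y)³)⁻¹ / 3`
  have h1 : ∫ y in Icc (x s - T) (x s - δ s / 2), f y ≤ 8 / (3 * δ s ^ 3) := by
    have hpq : x s - T ≤ x s - δ s / 2 := by linarith
    rw [integral_Icc_eq_integral_Ioc, ← intervalIntegral.integral_of_le hpq,
      intervalIntegral.integral_eq_sub_of_hasDerivAt (f := fun y => ((x s - y) ^ 3)⁻¹ / 3)]
    · have e1 : x s - (x s - δ s / 2) = δ s / 2 := by ring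
      have e2 : x s - (x s - T) = T := by ring
      rw [e1, e2]
      have : ((δ s / 2) ^ 3)⁻¹ / 3 - (T ^ 3)⁻¹ / 3 = 8 / (3 * δ s ^ 3) - 1 / (3 * T ^ 3) := by
        field_simp
        ring
      rw [this]
      have : 0 < 1 / (3 * T ^ 3) := by positivity
      linarith
    · intro y hy
      have hy' := havoid _ _ hpq (Or.inl (by linarith)) y hy
      have hne : x s - y ≠ 0 := sub_ne_zero.mpr (Ne.symm hy')
      have hne3 : (x s - y) ^ 3 ≠ 0 := pow_ne_zero 3 hne
      refine (((((hasDerivAt_id y).const_sub (x s)).fun_pow 3).fun_inv hne3).div_const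
        3).congr_deriv ?_
      simp only [hf, id_eq]
      field_simp
      ring
    · exact (hcont.mono fun y hy => havoid _ _ hpq (Or.inl (by linarith)) y hy).intervalIntegrable
  -- right piece, antiderivative `-((y - x_s)³)⁻¹ / 3`
  have h2 : ∫ y in Icc (x s + δ s / 2) (x s + T), f y ≤ 8 / (3 * δ s ^ 3) := by
    have hpq : x s + δ s / 2 ≤ x s + T := by linarith
    rw [integral_Icc_eq_integral_Ioc, ← intervalIntegral.integral_of_le hpq,
      intervalIntegral.integral_eq_sub_of_hasDerivAt (f := fun y => -((y - x s) ^ 3)⁻¹ / 3)]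
    · have e1 : x s + T - x s = T := by ring
      have e2 : x s + δ s / 2 - x s = δ s / 2 := by ring
      rw [e1, e2]
      have : -(T ^ 3)⁻¹ / 3 - -((δ s / 2) ^ 3)⁻¹ / 3 = 8 / (3 * δ s ^ 3) - 1 / (3 * T ^ 3) := by
        field_simp
        ring
      rw [this]
      have : 0 < 1 / (3 * T ^ 3) := by positivity
      linarith
    · intro y hy
      have hy' := havoid _ _ hpq (Or.inr (by linarith)) y hy
      have hne : y - x s ≠ 0 := sub_ne_zero.mpr hy'
      have hne3 : (y - x s) ^ 3 ≠ 0 := pow_ne_zero 3 hne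
      refine (((((hasDerivAt_id y).sub_const (x s)).fun_pow 3).fun_inv hne3).fun_neg.div_const
        3).congr_deriv ?_
      simp only [hf, id_eq]
      field_simp
      ring
    · exact (hcont.mono fun y hy => havoid _ _ hpq (Or.inr (by linarith)) y hy).intervalIntegrable
  calc ∑ r ∈ Finset.univ.erase s, δ r / (x r - x s) ^ 4
        = ∑ r ∈ Finset.univ.erase s, δ r * f (x r) := by
          refine Finset.sum_congr rfl fun r _ => ?_
          simp only [hf, div_eq_mul_inv]
    _ ≤ _ := key
    _ ≤ 8 / (3 * δ s ^ 3) + 8 / (3 * δ s ^ 3) := add_le_add h1 h2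
    _ = 16 / (3 * δ s ^ 3) := by ring

end OnePole

end Literature.NumberTheory.LFunctions.MontgomeryVaughan
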